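import Summits.QuantumFields.YangMills.Theorems.BalabanUVNodesN20KeyedGasClassCurrent

/-!
# BalabanUVNodes ∕ node N20 (NE7b) — (R′) AT THE KEYED GAS IS A PER-POLYMER LETTER: the road's two-run first-moment letter from per-polymer TWO-RUN CURRENT MATCHING on the
# loop's polymers (additivity of the increment's derivative + localisation + packing), and the road END TO END at the keyed gas with NO class-level R-side letter

Cell `pub-ymgap` (HUMAN RULING D-0062 Track A ∕ director-ym R399 (3a) second-wave width seats), WIDTH SEAT `pub-ymgap-dag-n20-w5` (node n20 = NE7b),
generation g5, CLAIM-3 ∕ INTENT-3 (bus).  Key item K3⁸ `SpineGivenEndpointR13SepCoPHV` (stmt-QuantumFields-27366; skeleton of record v6 b4e55110ab73e679, stub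
`stub_expansion13HV`) — K3⁷ stmt-QuantumFields-20544 aside; filed `--kind proof --supports … --as helper`.  COUNT-NEUTRAL.  THEOREMS ONLY (0 `def`, 0 `instance`,
0 `notation`, 0 `sorry`).  ADDITIVE — imports this seat's `…N20KeyedGasClassCurrent` ONLY (CLAIM-2; hence p626582, p627953, `B14Eq344PolymerRatio`); modifies nothing.

WHY.  After `…N20KeyedGasClassCurrent` the hellinger road at the keyed gas reads: (H) + (R′) + per-polymer letters ⇒ `HybridNE7`, with (R‑c) gone into per-polymer member
currents.  The remaining class-level R-side letter is (R′) `|E_{q_{K,s}}[B'∕B − A'∕A]| ≤ R₁ K`, `Σ R₁ < ∞` — the road's two-run FIRST-MOMENT letter (idea-3's card: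
THE unprinted two-run statement of the R-side).  At the keyed gas the two-run increment `h_X = log B_X − log A_X = Σ_{γ∈X}(log b_γ − log a_γ)` is ADDITIVE, so its source
derivative is the SUM of the members' current differences `b'_γ∕b_γ − a'_γ∕a_γ`; with localisation (no source dependence off the loop's polymers `N K`, for BOTH runs) and
packing (`|X ∩ N K| ≤ ν`) the class-level quantity is at most `ν · max_{γ ∈ N K} |b'_γ∕b_γ − a'_γ∕a_γ|` for EVERY class, hence so is its `q`-mean.  THIS FILE types that:
(R′) ⇐ (R′‑poly) «the two runs' activities of each source-carrying polymer have matching source log-derivatives up to a summable rate `ρ₁ K`», `R₁ K := ν·ρ₁ K`.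
* §1 [folklore] ONE family: ★ `classIncrementDeriv_eq_sum` (`B'_X∕B_X − A'_X∕A_X = Σ_{γ∈X}(b'_γ∕b_γ − a'_γ∕a_γ)`) · ★★ `abs_classIncrementDeriv_le_card_mul` (localisation for
  both runs + matching `|b'∕b − a'∕a| ≤ ρ` on `X ∩ N` ⇒ `|B'_X∕B_X − A'_X∕A_X| ≤ |X ∩ N|·ρ`).
* §2 ★★★ `responseLetter_keyedGas_of_polymerCurrentMatching` — ALONG `K` at the keyed carriers: positivity of both runs' activities, localisation for both runs off `N K`,
  the packing letter, and (R′‑poly) `|b'∕b − a'∕a| ≤ ρ₁ K` on `N K` (`ρ₁ ≥ 0`) ⇒ the road's `hR` letter VERBATIM (product-rule derivative carriers, run-B class law `q`)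
  with `R₁ K := ν·ρ₁ K` — `q` is a probability, so the mean of a quantity bounded class by class is bounded.
* §3 ★★★ `exists_hybridNE7_keyedGas_of_affinityDefectLetter_and_polymerLetters` — `…N20KeyedGasClassCurrent`'s §4 with its (R′) input SUPPLIED by §2: (H) in the
  ∃-shape (ANY keyed-gas supplier) + per-polymer letters ONLY on the R-side (positivity, differentiability, localisation ×2, run A's member currents `|a'| ≤ M₀a`,
  (R′‑poly) with `Σ ρ₁ < ∞`, packing) ⇒ `∃ η Wsh shA shB, (H) ∧ Σ√η<∞ ∧ budget bounds ∧ HybridNE7 l₀ vol T A B ∅ 0 shA shB Wsh (K ↦ l₀·(ν ρ₁ K + 2√(2η_K)·M₀ν)∕vol)`.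
* §4 toy (A6): the empty polymer system inhabits §3 end to end.
READING (located, nothing proposed).  (i) The R-side of the road at the keyed gas is now THREE per-polymer letters on the `≤ ν` source-carrying polymers per class —
member currents (one run), CURRENT MATCHING (two runs), localisation — plus packing; (R′‑poly) is where the two-run content sits: the final-scale activity of a polymer
at the loop computed by runs of length `K` and `K + 1` must have source log-derivatives within `ρ₁ K`, `Σ_K ρ₁ K < ∞` — a LOCAL two-run statement (finitely many
polymers per class, one derivative each), the natural R-side companion of the V-side's (V‑b)=(YG) ∕ (KR) letters; UNPRINTED for d = 4 like (R′) itself, NOT claimed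
smaller than (R′) in content — only in FORM (per polymer instead of per class law).  (ii) `ν` K-uniform ⇐ source at the final scale (READING (i) of
`…N20KeyedGasClassCurrent`).  (iii) Nothing here touches (H)'s suppliers.

HONEST FRAMING.  [folklore] finite-sum bookkeeping + by-name transfer through `…N20KeyedGasClassCurrent` (hence p626582, p623765, p619159, p609004); every
per-polymer letter ((R′‑poly), member currents, localisation, positivity, differentiability), the packing letter and (H)'s suppliers' letters are HYPOTHESES produced by
nobody — (R′‑poly) and (V‑b) two-run, UNPRINTED for d = 4; NO estimate of Bałaban's programme is proved; nothing of Bałaban's asserted or instantiated (no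
`Provisos₁₃SepCoPH` tuple — K0⁷ OPEN); NE7 ∕ NE7b ∕ NE7c NOT PRINTED as two-run statements for d = 4 and NOT proved; N19′ ∕ N20 ∕ N21 NOT discharged; K3⁸ OPEN (v6
STANDS), K3⁷ aside, neither claimed; no summit statement is proved by this seat; counts UNMOVED (typed 28∕28 · discharged 5∕28; 5∕27 excl. NODE O).  One finite
four-torus programme at fixed ε — NOT ℝ⁴, NOT infinite volume, NOT OS, NOT a mass gap, NOT the Clay problem (R4 closes the conditional finite-𝕋⁴ rung `BalabanLadder.UV`
only).  0 `def`; 0 `sorry`; standard axioms; no cite tags.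
-/

noncomputable section

namespace Summit.QuantumFields.YangMills.BalabanUVNodes.N20KeyedGasResponseLetter

open Finset
open Literature.Probability.LatticeModels (IsCompatible)
open Literature.MathematicalPhysics.QuantumFieldTheory.Balaban1983to89
open T4MatchingAssembly (HybridNE7)
open Summit.QuantumFields.YangMills.BalabanUVNodes.N20KeyedGasClassCurrent
open Summit.QuantumFields.YangMills.BalabanUVNodes.N19TameTiltLetterOfKPMarginRegimeFree (affinityDefectLetter_of_kpMargin)

variable {P : Type*} [DecidableEq P]

/-! ## §1 One compatible family: the source derivative of the two-run increment is the SUM of the members' current differences [folklore] -/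
section OneFamily
variable {X : Finset P}

/-- [folklore] **THE INCREMENT'S DERIVATIVE IS ADDITIVE.**  For non-vanishing activities of both runs on `X`, the source derivative of the two-run increment
`h_X = log B_X − log A_X`, i.e. the difference of the class currents `B'_X∕B_X − A'_X∕A_X`, is the SUM over the members of the per-polymer current differences
`b'_γ∕b_γ − a'_γ∕a_γ` (`classCurrent_eq_sum_currents` twice). -/
theorem classIncrementDeriv_eq_sum {a a' b b' : P → ℝ} (ha : ∀ γ ∈ X, a γ ≠ 0) (hb : ∀ γ ∈ X, b γ ≠ 0) :
    (∑ γ ∈ X, (∏ γ' ∈ X.erase γ, b γ') * b' γ) / (∏ γ ∈ X, b γ) - (∑ γ ∈ X, (∏ γ' ∈ X.erase γ, a γ') * a' γ) / (∏ γ ∈ X, a γ)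
      = ∑ γ ∈ X, (b' γ / b γ - a' γ / a γ) := by
  rw [classCurrent_eq_sum_currents hb, classCurrent_eq_sum_currents ha, sum_sub_distrib]

/-- [folklore] **LOCALISED PER-POLYMER CURRENT MATCHING ⇒ BOUNDED INCREMENT DERIVATIVE, LINEAR IN THE NUMBER OF SOURCE-CARRYING MEMBERS.**  Both runs' activities
non-vanishing on `X` and source-free off `N` (`a' = b' = 0`), and on `X ∩ N` the two runs' member currents MATCH up to `ρ`: `|b'_γ∕b_γ − a'_γ∕a_γ| ≤ ρ` ⇒
`|B'_X∕B_X − A'_X∕A_X| ≤ |X ∩ N|·ρ`. -/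
theorem abs_classIncrementDeriv_le_card_mul {a a' b b' : P → ℝ} (N : Finset P) {ρ : ℝ} (ha : ∀ γ ∈ X, a γ ≠ 0) (hb : ∀ γ ∈ X, b γ ≠ 0)
    (hlocA : ∀ γ ∈ X, γ ∉ N → a' γ = 0) (hlocB : ∀ γ ∈ X, γ ∉ N → b' γ = 0)
    (hmatch : ∀ γ ∈ X, γ ∈ N → |b' γ / b γ - a' γ / a γ| ≤ ρ) :
    |(∑ γ ∈ X, (∏ γ' ∈ X.erase γ, b γ') * b' γ) / (∏ γ ∈ X, b γ) - (∑ γ ∈ X, (∏ γ' ∈ X.erase γ, a γ') * a' γ) / (∏ γ ∈ X, a γ)|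
      ≤ (X ∩ N).card * ρ := by
  rw [classIncrementDeriv_eq_sum ha hb, ← sum_filter_add_sum_filter_not X (fun γ => γ ∈ N), filter_mem_eq_inter]
  have h0 : ∑ γ ∈ X.filter (fun γ => ¬ γ ∈ N), (b' γ / b γ - a' γ / a γ) = 0 :=
    sum_eq_zero fun γ hγ => by rw [mem_filter] at hγ; rw [hlocA γ hγ.1 hγ.2, hlocB γ hγ.1 hγ.2]; simp
  rw [h0, add_zero]
  calc |∑ γ ∈ X ∩ N, (b' γ / b γ - a' γ / a γ)| ≤ ∑ γ ∈ X ∩ N, |b' γ / b γ - a' γ / a γ| := abs_sum_le_sum_abs _ _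
    _ ≤ ∑ _γ ∈ X ∩ N, ρ := sum_le_sum fun γ hγ => hmatch γ (mem_inter.1 hγ).1 (mem_inter.1 hγ).2
    _ = (X ∩ N).card * ρ := by rw [sum_const, nsmul_eq_mul]

end OneFamily

/-! ## §2 Along `K`: the road's (R′) letter at the keyed-gas carriers from per-polymer two-run current matching + localisation + packing [folklore] -/
section ResponseLetter
variable (inc : P → P → Prop) [DecidableRel inc] {l₀ : ℝ}

/-- **★★★ (R′) AT THE KEYED GAS FROM PER-POLYMER TWO-RUN CURRENT MATCHING** [folklore].  Polymer sets `Λ K`, both runs' activities positive on `|s| ≤ l₀`, SOURCE-CARRYING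
sets `N K` off which NEITHER run's activity depends on the source (`a' = b' = 0`), the PACKING letter `|X ∩ N K| ≤ ν` for compatible `X ⊆ Λ K` (`packing_of_cliques`),
and the per-polymer TWO-RUN CURRENT MATCHING letter `|b'_γ∕b_γ − a'_γ∕a_γ| ≤ ρ₁ K` (`ρ₁ ≥ 0`) on `Λ K ∩ N K` ⇒ the road's (R′) letter at the keyed-gas carriers with the product-rule
derivative carriers and `R₁ K := ν·ρ₁ K`:  `|Σ_X q_{K,s}(X)·(B'_X∕B_X − A'_X∕A_X)| ≤ ν·ρ₁ K` (the run-B class law `q` is a probability).  With `Σ_K ρ₁ K < ∞` this is the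
`(hR, hRs)` pair of every `exists_hybridNE7_…` edition of the road. -/
theorem responseLetter_keyedGas_of_polymerCurrentMatching (Λ N : ℕ → Finset P) (a b a' b' : ℕ → ℝ → P → ℝ) (ν : ℕ) (ρ₁ : ℕ → ℝ)
    (ha : ∀ K s, |s| ≤ l₀ → ∀ γ ∈ Λ K, 0 < a K s γ) (hb : ∀ K s, |s| ≤ l₀ → ∀ γ ∈ Λ K, 0 < b K s γ)
    (hlocA : ∀ K s, |s| ≤ l₀ → ∀ γ ∈ Λ K, γ ∉ N K → a' K s γ = 0) (hlocB : ∀ K s, |s| ≤ l₀ → ∀ γ ∈ Λ K, γ ∉ N K → b' K s γ = 0)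
    (hν : ∀ K, ∀ X ∈ (Λ K).powerset.filter (fun X => IsCompatible inc X), (X ∩ N K).card ≤ ν)
    (hρ₁ : ∀ K, 0 ≤ ρ₁ K)
    (hmatch : ∀ K s, |s| ≤ l₀ → ∀ γ ∈ Λ K, γ ∈ N K → |b' K s γ / b K s γ - a' K s γ / a K s γ| ≤ ρ₁ K) :
    ∀ (K : ℕ) (s : ℝ), |s| ≤ l₀ →
      |∑ X ∈ (Λ K).powerset with IsCompatible inc X,
          (∏ γ ∈ X, b K s γ) / (∑ Y ∈ (Λ K).powerset with IsCompatible inc Y, ∏ γ ∈ Y, b K s γ)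
            * ((∑ γ ∈ X, (∏ γ' ∈ X.erase γ, b K s γ') * b' K s γ) / (∏ γ ∈ X, b K s γ)
              - (∑ γ ∈ X, (∏ γ' ∈ X.erase γ, a K s γ') * a' K s γ) / (∏ γ ∈ X, a K s γ))| ≤ ν * ρ₁ K := by
  intro K s hs
  obtain ⟨hBpos, hZB⟩ := classWeight_pos_and_sum_pos inc Λ b hb
  set T := (Λ K).powerset.filter (fun X => IsCompatible inc X) with hT
  have hq0 : ∀ X ∈ T, 0 ≤ (∏ γ ∈ X, b K s γ) / (∑ Y ∈ T, ∏ γ ∈ Y, b K s γ) :=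
    fun X hX => div_nonneg (hBpos K s hs X hX).le (hZB K s hs).le
  have hq1 : ∑ X ∈ T, (∏ γ ∈ X, b K s γ) / (∑ Y ∈ T, ∏ γ ∈ Y, b K s γ) = 1 := by
    rw [← sum_div, div_self (hZB K s hs).ne']
  have hbdX : ∀ X ∈ T,
      |(∑ γ ∈ X, (∏ γ' ∈ X.erase γ, b K s γ') * b' K s γ) / (∏ γ ∈ X, b K s γ)
        - (∑ γ ∈ X, (∏ γ' ∈ X.erase γ, a K s γ') * a' K s γ) / (∏ γ ∈ X, a K s γ)| ≤ ν * ρ₁ K := by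
    intro X hX
    have hXΛ : X ⊆ Λ K := mem_powerset.1 (mem_filter.1 hX).1
    have h1 := abs_classIncrementDeriv_le_card_mul (X := X) (N K) (fun γ hγ => (ha K s hs γ (hXΛ hγ)).ne')
      (fun γ hγ => (hb K s hs γ (hXΛ hγ)).ne') (fun γ hγ hγN => hlocA K s hs γ (hXΛ hγ) hγN)
      (fun γ hγ hγN => hlocB K s hs γ (hXΛ hγ) hγN) (fun γ hγ hγN => hmatch K s hs γ (hXΛ hγ) hγN)
    have hρ : 0 ≤ ρ₁ K := hρ₁ K
    have h2 : (((X ∩ N K).card : ℕ) : ℝ) ≤ ν := by exact_mod_cast hν K X hX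
    calc _ ≤ (X ∩ N K).card * ρ₁ K := h1
      _ ≤ ν * ρ₁ K := by gcongr
  calc |∑ X ∈ T, (∏ γ ∈ X, b K s γ) / (∑ Y ∈ T, ∏ γ ∈ Y, b K s γ)
          * ((∑ γ ∈ X, (∏ γ' ∈ X.erase γ, b K s γ') * b' K s γ) / (∏ γ ∈ X, b K s γ)
            - (∑ γ ∈ X, (∏ γ' ∈ X.erase γ, a K s γ') * a' K s γ) / (∏ γ ∈ X, a K s γ))|
      ≤ ∑ X ∈ T, |(∏ γ ∈ X, b K s γ) / (∑ Y ∈ T, ∏ γ ∈ Y, b K s γ)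
          * ((∑ γ ∈ X, (∏ γ' ∈ X.erase γ, b K s γ') * b' K s γ) / (∏ γ ∈ X, b K s γ)
            - (∑ γ ∈ X, (∏ γ' ∈ X.erase γ, a K s γ') * a' K s γ) / (∏ γ ∈ X, a K s γ))| := abs_sum_le_sum_abs _ _
    _ ≤ ∑ X ∈ T, (∏ γ ∈ X, b K s γ) / (∑ Y ∈ T, ∏ γ ∈ Y, b K s γ) * (ν * ρ₁ K) := sum_le_sum fun X hX => by
        rw [abs_mul, abs_of_nonneg (hq0 X hX)]
        exact mul_le_mul_of_nonneg_left (hbdX X hX) (hq0 X hX)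
    _ = ν * ρ₁ K := by rw [← sum_mul, hq1, one_mul]

end ResponseLetter

/-! ## §3 END TO END at the keyed gas with BOTH R-side letters made per-polymer: (H) + per-polymer letters ⇒ `HybridNE7` [by-name through `…N20KeyedGasClassCurrent`] -/
section Road
variable (inc : P → P → Prop) [DecidableRel inc] {l₀ vol : ℝ}

/-- **★★★ `HybridNE7` AT THE KEYED GAS FROM THE (H) LETTER AND PER-POLYMER LETTERS ONLY ON THE R-SIDE** [folklore + by-name:
`exists_hybridNE7_keyedGas_of_affinityDefectLetter_response_polymerCurrents` with its (R′) input supplied by `responseLetter_keyedGas_of_polymerCurrentMatching`].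
Letters: per-polymer positivity and differentiability of both runs' activities on `|s| ≤ l₀`; the E1∕E2 dictionary; (H) in the ∃-shape at the keyed carriers (ANY
supplier); SOURCE-CARRYING sets `N K` off which neither run's activity depends on the source; run A's member currents `|a'| ≤ M₀ a` on `N K`; the per-polymer TWO-RUN
CURRENT MATCHING `|b'∕b − a'∕a| ≤ ρ₁ K` on `N K` with `ρ₁ ≥ 0`, `Σ ρ₁ < ∞`; the PACKING letter `|X ∩ N K| ≤ ν`.  Conclusion: `∃ η Wsh shA shB` with (H), `Σ√η < ∞`, the
budget bounds and `HybridNE7 l₀ vol T A B (fun _ _ => ∅) (fun _ => 0) shA shB Wsh (K ↦ l₀·(ν·ρ₁ K + 2√(2η_K)·(M₀ν))∕vol)` — NO class-level letter left on the R-side. -/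
theorem exists_hybridNE7_keyedGas_of_affinityDefectLetter_and_polymerLetters (hl₀ : 0 ≤ l₀) (hvol : 0 < vol)
    (Λ : ℕ → Finset P) (a b a' b' : ℕ → ℝ → P → ℝ)
    (ha : ∀ K s, |s| ≤ l₀ → ∀ γ ∈ Λ K, 0 < a K s γ) (hb : ∀ K s, |s| ≤ l₀ → ∀ γ ∈ Λ K, 0 < b K s γ)
    (hda : ∀ K s, |s| ≤ l₀ → ∀ γ ∈ Λ K, HasDerivAt (fun u => a K u γ) (a' K s γ) s)
    (hdb : ∀ K s, |s| ≤ l₀ → ∀ γ ∈ Λ K, HasDerivAt (fun u => b K u γ) (b' K s γ) s)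
    {Z : ℕ → ℝ → ℝ}
    (hZA' : ∀ (K : ℕ) (t : ℝ), |t| ≤ l₀ → Z K t = ∑ X ∈ (Λ K).powerset with IsCompatible inc X, ∏ γ ∈ X, a K t γ)
    (hZB' : ∀ (K : ℕ) (t : ℝ), |t| ≤ l₀ → Z (K + 1) t = ∑ X ∈ (Λ K).powerset with IsCompatible inc X, ∏ γ ∈ X, b K t γ)
    (hHex : ∃ η : ℕ → ℝ, (∀ K, 0 ≤ η K) ∧ Summable (fun K => Real.sqrt (η K)) ∧
      ∀ (K : ℕ) (t : ℝ), |t| ≤ l₀ →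
        1 - ∑ X ∈ (Λ K).powerset with IsCompatible inc X,
          Real.sqrt (((∏ γ ∈ X, a K t γ) / ∑ Y ∈ (Λ K).powerset with IsCompatible inc Y, ∏ γ ∈ Y, a K t γ)
            * ((∏ γ ∈ X, b K t γ) / ∑ Y ∈ (Λ K).powerset with IsCompatible inc Y, ∏ γ ∈ Y, b K t γ)) ≤ η K)
    -- the source-carrying polymers: localisation (both runs), run A's member currents, two-run current matching, packing
    (N : ℕ → Finset P) {M₀ : ℝ} (hM₀ : 0 ≤ M₀) (ν : ℕ) (ρ₁ : ℕ → ℝ) (hρ₁ : ∀ K, 0 ≤ ρ₁ K) (hρ₁s : Summable ρ₁)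
    (hlocA : ∀ K s, |s| ≤ l₀ → ∀ γ ∈ Λ K, γ ∉ N K → a' K s γ = 0) (hlocB : ∀ K s, |s| ≤ l₀ → ∀ γ ∈ Λ K, γ ∉ N K → b' K s γ = 0)
    (hcur : ∀ K s, |s| ≤ l₀ → ∀ γ ∈ Λ K, γ ∈ N K → |a' K s γ| ≤ M₀ * a K s γ)
    (hmatch : ∀ K s, |s| ≤ l₀ → ∀ γ ∈ Λ K, γ ∈ N K → |b' K s γ / b K s γ - a' K s γ / a K s γ| ≤ ρ₁ K)
    (hν : ∀ K, ∀ X ∈ (Λ K).powerset.filter (fun X => IsCompatible inc X), (X ∩ N K).card ≤ ν) :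
    ∃ (η Wsh : ℕ → ℝ) (shA shB : ℕ → ℝ → Finset P → ℝ),
      (∀ (K : ℕ) (t : ℝ), |t| ≤ l₀ →
        1 - ∑ X ∈ (Λ K).powerset with IsCompatible inc X,
          Real.sqrt (((∏ γ ∈ X, a K t γ) / ∑ Y ∈ (Λ K).powerset with IsCompatible inc Y, ∏ γ ∈ Y, a K t γ)
            * ((∏ γ ∈ X, b K t γ) / ∑ Y ∈ (Λ K).powerset with IsCompatible inc Y, ∏ γ ∈ Y, b K t γ)) ≤ η K) ∧
      Summable (fun K => Real.sqrt (η K)) ∧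
      (∀ K, 0 ≤ Wsh K ∧ Wsh K ≤ Real.sqrt (2 * η K) ∧ Wsh K < 1) ∧
      HybridNE7 l₀ vol (fun K => (Λ K).powerset.filter (fun X => IsCompatible inc X)) (fun K t X => ∏ γ ∈ X, a K t γ) (fun K t X => ∏ γ ∈ X, b K t γ)
        (fun _ _ => ∅) (fun _ => 0) shA shB Wsh
        (fun K => l₀ * ((ν : ℝ) * ρ₁ K + 2 * Real.sqrt (2 * η K) * (M₀ * ν)) / vol) :=
  exists_hybridNE7_keyedGas_of_affinityDefectLetter_response_polymerCurrents inc hl₀ hvol Λ a b a' b' ha hb hda hdb hZA' hZB' hHex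
    (R₁ := fun K => (ν : ℝ) * ρ₁ K)
    (responseLetter_keyedGas_of_polymerCurrentMatching inc Λ N a b a' b' ν ρ₁ ha hb hlocA hlocB hν hρ₁ hmatch)
    (hρ₁s.mul_left _) N hM₀ ν hlocA hcur hν

end Road

/-! ## §4 Toy (A6): the empty polymer system inhabits §3 end to end [folklore] -/
section Toy
variable (inc : P → P → Prop) [DecidableRel inc]

/-- **★ TOY — `HybridNE7` AT THE KEYED GAS OF NO POLYMERS, THROUGH §3** (A6): `Λ K = ∅`, activities `1` with derivative `0`, `Z ≡ 1`, (H) with `η = 0`, no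
source-carrying polymer (`N = ∅`, `M₀ = 0`, `ν = 0`, `ρ₁ = 0`), `l₀ = 0`, `vol = 1` — every antecedent met by a genuine witness, `HybridNE7` exhibited. -/
theorem toy_hybridNE7_noPolymers_perPolymer :
    ∃ (η Wsh : ℕ → ℝ) (shA shB : ℕ → ℝ → Finset P → ℝ),
      (∀ (K : ℕ) (t : ℝ), |t| ≤ 0 →
        1 - ∑ X ∈ ((fun _ : ℕ => (∅ : Finset P)) K).powerset with IsCompatible inc X,
          Real.sqrt (((∏ γ ∈ X, (fun (_ : ℕ) (_ : ℝ) (_ : P) => (1:ℝ)) K t γ)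
              / ∑ Y ∈ ((fun _ : ℕ => (∅ : Finset P)) K).powerset with IsCompatible inc Y, ∏ γ ∈ Y, (fun (_ : ℕ) (_ : ℝ) (_ : P) => (1:ℝ)) K t γ)
            * ((∏ γ ∈ X, (fun (_ : ℕ) (_ : ℝ) (_ : P) => (1:ℝ)) K t γ)
              / ∑ Y ∈ ((fun _ : ℕ => (∅ : Finset P)) K).powerset with IsCompatible inc Y, ∏ γ ∈ Y, (fun (_ : ℕ) (_ : ℝ) (_ : P) => (1:ℝ)) K t γ)) ≤ η K) ∧
      Summable (fun K => Real.sqrt (η K)) ∧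
      (∀ K, 0 ≤ Wsh K ∧ Wsh K ≤ Real.sqrt (2 * η K) ∧ Wsh K < 1) ∧
      HybridNE7 0 1 (fun K => ((fun _ : ℕ => (∅ : Finset P)) K).powerset.filter (fun X => IsCompatible inc X))
        (fun K t X => ∏ γ ∈ X, (fun (_ : ℕ) (_ : ℝ) (_ : P) => (1:ℝ)) K t γ) (fun K t X => ∏ γ ∈ X, (fun (_ : ℕ) (_ : ℝ) (_ : P) => (1:ℝ)) K t γ)
        (fun _ _ => ∅) (fun _ => 0) shA shB Wsh
        (fun K => 0 * (((0:ℕ) : ℝ) * (fun _ : ℕ => (0:ℝ)) K + 2 * Real.sqrt (2 * η K) * ((0:ℝ) * ((0:ℕ) : ℝ))) / 1) := by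
  have hT := keyedCarrier_empty inc
  refine exists_hybridNE7_keyedGas_of_affinityDefectLetter_and_polymerLetters inc le_rfl one_pos (fun _ => ∅)
    (fun _ _ _ => (1:ℝ)) (fun _ _ _ => (1:ℝ)) (fun _ _ _ => 0) (fun _ _ _ => 0)
    (fun _ _ _ γ hγ => absurd hγ (notMem_empty γ)) (fun _ _ _ γ hγ => absurd hγ (notMem_empty γ))
    (fun _ _ _ γ hγ => absurd hγ (notMem_empty γ)) (fun _ _ _ γ hγ => absurd hγ (notMem_empty γ))
    (Z := fun _ _ => 1) (fun _ _ _ => by simp [hT]) (fun _ _ _ => by simp [hT])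
    ⟨fun _ => 0, fun _ => le_rfl, by simp [summable_zero], fun _ _ _ => by simp [hT]⟩
    (fun _ => ∅) (M₀ := 0) le_rfl 0 (fun _ => 0) (fun _ => le_rfl) summable_zero
    (fun _ _ _ γ hγ => absurd hγ (notMem_empty γ)) (fun _ _ _ γ hγ => absurd hγ (notMem_empty γ))
    (fun _ _ _ γ hγ => absurd hγ (notMem_empty γ)) (fun _ _ _ γ hγ => absurd hγ (notMem_empty γ))
    (fun _ X _ => by simp)

end Toy

end Summit.QuantumFields.YangMills.BalabanUVNodes.N20KeyedGasResponseLetter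
end
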